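import Summits.AtomisticToContinuum.Crystallization.Theorems.FreeSplittingCertificatesStrictSplittingRuleTorusQFormReal
import Summits.AtomisticToContinuum.Crystallization.Theorems.FreeSplittingCertificatesStrictSplittingRuleTorusParamEnclosure

/-!
# Box certificates for parametrised term-list forms: the glue

Given term lists `P k` (the monomial pieces of a parametrised quadratic form `Σ_k t_k(a,h)·P_k(v)`), their absolute
majorants, affine enclosures of the coefficient functions `t_k` on the `(a,h)`-box, and a fixed majorant list `E`
(boxed data such as `β′`), nonnegativity of the FOUR corner term lists (each a single rational `PSD.IsGramCertDD`
certificate via `evalQR_nonneg_of_certDD`) gives `Σ_k t_k(a,h)·P_k(v) − E(v) ≥ 0` at every point of the box and every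
real field `v`.  [folklore]
-/

namespace Summit.AtomisticToContinuum.Crystallization.Theorems.StrictSplittingRuleTorusLMI

open Literature.Computation.Certificates

variable {N : ℕ}

/-- Absolute majorant of a term list: `(c, ℓ, ℓ′) ↦ (|c|/2, ℓ, ℓ), (|c|/2, ℓ′, ℓ′)`. [folklore] -/
def absTerms (ts : List (Term N)) : List (Term N) :=
  ts.flatMap fun t => [(|t.1| / 2, t.2.1, t.2.1), (|t.1| / 2, t.2.2, t.2.2)]

/-- `|Σ c·ℓ(v)·ℓ′(v)| ≤ Σ |c|·(ℓ(v)² + ℓ′(v)²)/2`. [folklore] -/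
theorem abs_evalQR_le_absTerms (ts : List (Term N)) (v : Fin N → ℝ) :
    |evalQR ts v| ≤ evalQR (absTerms ts) v := by
  induction ts with
  | nil => simp [absTerms]
  | cons t ts ih =>
    rw [evalQR_cons]
    have hsplit : absTerms (t :: ts) = [(|t.1| / 2, t.2.1, t.2.1), (|t.1| / 2, t.2.2, t.2.2)] ++ absTerms ts := by
      simp [absTerms]
    rw [hsplit, evalQR_append, evalQR_cons, evalQR_cons, evalQR_nil]
    have h1 : |(t.1 : ℝ) * t.2.1.evalR v * t.2.2.evalR v| ≤
        (|t.1| / 2 : ℚ) * t.2.1.evalR v * t.2.1.evalR v + ((|t.1| / 2 : ℚ) * t.2.2.evalR v * t.2.2.evalR v + 0) := by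
      rw [abs_mul, abs_mul]
      push_cast
      have h2 : |(t.2.1.evalR v : ℝ)| * |t.2.2.evalR v| ≤ ((t.2.1.evalR v) ^ 2 + (t.2.2.evalR v) ^ 2) / 2 := by
        rw [← abs_mul]
        have := two_mul_le_add_sq (t.2.1.evalR v : ℝ) (t.2.2.evalR v)
        have h3 : |t.2.1.evalR v * t.2.2.evalR v| ≤ ((t.2.1.evalR v) ^ 2 + (t.2.2.evalR v) ^ 2) / 2 := by
          rw [abs_le]; constructor
          · nlinarith [two_mul_le_add_sq (t.2.1.evalR v : ℝ) (-(t.2.2.evalR v))]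
          · linarith
        exact h3
      have hc : (0 : ℝ) ≤ |(t.1 : ℝ)| := abs_nonneg _
      calc |(t.1 : ℝ)| * |LinF.evalR t.2.1 v| * |LinF.evalR t.2.2 v|
          = |(t.1 : ℝ)| * (|LinF.evalR t.2.1 v| * |LinF.evalR t.2.2 v|) := by ring
        _ ≤ |(t.1 : ℝ)| * (((t.2.1.evalR v) ^ 2 + (t.2.2.evalR v) ^ 2) / 2) := mul_le_mul_of_nonneg_left h2 hc
        _ = _ := by ring
    calc |(t.1 : ℝ) * t.2.1.evalR v * t.2.2.evalR v + evalQR ts v|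
        ≤ |(t.1 : ℝ) * t.2.1.evalR v * t.2.2.evalR v| + |evalQR ts v| := abs_add_le _ _
      _ ≤ _ := add_le_add h1 ih

/-- Scaling a term list by a rational. [folklore] -/
def smulTerms (q : ℚ) (ts : List (Term N)) : List (Term N) := ts.map fun t => (q * t.1, t.2.1, t.2.2)

/-- `evalQR (smulTerms q ts) v = q · evalQR ts v`. [folklore] -/
theorem evalQR_smulTerms (q : ℚ) (ts : List (Term N)) (v : Fin N → ℝ) :
    evalQR (smulTerms q ts) v = (q : ℝ) * evalQR ts v := by
  induction ts with
  | nil => simp [smulTerms]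
  | cons t ts ih =>
    simp only [smulTerms, List.map_cons, evalQR_cons] at ih ⊢
    rw [ih]; push_cast; ring

/-- `evalQR` of a flattened family is the sum. [folklore] -/
theorem evalQR_flatMap {K : ℕ} (f : Fin K → List (Term N)) (v : Fin N → ℝ) :
    evalQR ((List.finRange K).flatMap f) v = ∑ k, evalQR (f k) v := by
  have key : ∀ (l : List (Fin K)), evalQR (l.flatMap f) v = (l.map fun k => evalQR (f k) v).sum := by
    intro l
    induction l with
    | nil => simp
    | cons k l ih => rw [List.flatMap_cons, evalQR_append, ih, List.map_cons, List.sum_cons]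
  rw [key, ← List.sum_toFinset _ (List.nodup_finRange K)]
  simp [List.toFinset_finRange]

/-- The corner term list for sign pattern `(sa, sh)`: `Σ_k (c₀ + sa·Δ·c₁ + sh·Δ·c₂)_k · P_k − Σ_k ρ_k · P⁺_k − E`. [folklore] -/
def cornerTerms {K : ℕ} (Δ : ℚ) (P Pabs : Fin K → List (Term N)) (c₀ c₁ c₂ ρ : Fin K → ℚ) (E : List (Term N))
    (sa sh : ℚ) : List (Term N) :=
  (List.finRange K).flatMap (fun k => smulTerms (c₀ k + sa * Δ * c₁ k + sh * Δ * c₂ k) (P k)) ++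
    ((List.finRange K).flatMap (fun k => smulTerms (-ρ k) (Pabs k)) ++ smulTerms (-1) E)

/-- Value of the corner term list. [folklore] -/
theorem evalQR_cornerTerms {K : ℕ} (Δ : ℚ) (P Pabs : Fin K → List (Term N)) (c₀ c₁ c₂ ρ : Fin K → ℚ)
    (E : List (Term N)) (sa sh : ℚ) (v : Fin N → ℝ) :
    evalQR (cornerTerms Δ P Pabs c₀ c₁ c₂ ρ E sa sh) v =
      (∑ k, ((c₀ k + sa * Δ * c₁ k + sh * Δ * c₂ k : ℚ) : ℝ) * evalQR (P k) v) -
        (∑ k, (ρ k : ℝ) * evalQR (Pabs k) v) - evalQR E v := by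
  simp only [cornerTerms, evalQR_append, evalQR_flatMap, evalQR_smulTerms]
  push_cast
  simp only [neg_mul, Finset.sum_neg_distrib, one_mul]
  ring

/-- **Box certificate glue.**  If every coefficient function `t k` is affinely enclosed with data `(c₀,c₁,c₂,ρ)_k`, `Pabs k`
majorises `|P k|`, and the four corner term lists are nonnegative forms, then for every `(a,h)` in the box and every real
field `v`: `E(v) ≤ Σ_k t_k(a,h) · P_k(v)`. [folklore] -/
theorem paramForm_ge_of_corners {K : ℕ} {a₀ h₀ Δ : ℚ} (hΔ : 0 ≤ Δ) (P Pabs : Fin K → List (Term N))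
    (hPabs : ∀ k (v : Fin N → ℝ), |evalQR (P k) v| ≤ evalQR (Pabs k) v) (t : Fin K → ℝ → ℝ → ℝ)
    (c₀ c₁ c₂ ρ : Fin K → ℚ)
    (henc : ∀ k, AffEncl (a₀ : ℝ) h₀ Δ (t k) (c₀ k) (c₁ k) (c₂ k) (ρ k)) (E : List (Term N))
    (hcorner : ∀ sa ∈ ({1, -1} : Finset ℚ), ∀ sh ∈ ({1, -1} : Finset ℚ), ∀ v : Fin N → ℝ,
      0 ≤ evalQR (cornerTerms Δ P Pabs c₀ c₁ c₂ ρ E sa sh) v)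
    {a h : ℝ} (ha : |a - a₀| ≤ Δ) (hh : |h - h₀| ≤ Δ) (v : Fin N → ℝ) :
    evalQR E v ≤ ∑ k, t k a h * evalQR (P k) v := by
  -- step 1: enclosures
  have h1 := AffEncl.sum_mul_ge (a₀ := (a₀ : ℝ)) (h₀ := (h₀ : ℝ)) (Δ := (Δ : ℝ)) Finset.univ
    (t := t) (c₀ := fun k => (c₀ k : ℝ)) (c₁ := fun k => (c₁ k : ℝ)) (c₂ := fun k => (c₂ k : ℝ))
    (ρ := fun k => (ρ k : ℝ)) (fun k _ => henc k) (fun k => evalQR (P k) v) ha hh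
  -- step 2: majorants |P k v| ≤ Pabs k v and ρ k ≥ 0
  have hρ : ∀ k, (0 : ℝ) ≤ ρ k := fun k =>
    (abs_nonneg _).trans ((henc k) a₀ h₀ (by simp [hΔ]) (by simp [hΔ]))
  have h2 : ∑ k, (ρ k : ℝ) * |evalQR (P k) v| ≤ ∑ k, (ρ k : ℝ) * evalQR (Pabs k) v :=
    Finset.sum_le_sum fun k _ => mul_le_mul_of_nonneg_left (hPabs k v) (hρ k)
  -- step 3: the affine family is ≥ Σ ρ Pabs + E at the corners, hence on the box
  set α : ℝ := (∑ k, (c₀ k : ℝ) * evalQR (P k) v) - (∑ k, (ρ k : ℝ) * evalQR (Pabs k) v) - evalQR E v with hα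
  set β : ℝ := ∑ k, (c₁ k : ℝ) * evalQR (P k) v with hβ
  set γ : ℝ := ∑ k, (c₂ k : ℝ) * evalQR (P k) v with hγ
  have hc : ∀ sa sh : ℚ, evalQR (cornerTerms Δ P Pabs c₀ c₁ c₂ ρ E sa sh) v = α + β * (sa * Δ) + γ * (sh * Δ) := by
    intro sa sh
    have hsum : (∑ k, ((c₀ k + sa * Δ * c₁ k + sh * Δ * c₂ k : ℚ) : ℝ) * evalQR (P k) v)
        = (∑ k, (c₀ k : ℝ) * evalQR (P k) v) + ((sa * Δ : ℚ) : ℝ) * β + ((sh * Δ : ℚ) : ℝ) * γ := by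
      rw [hβ, hγ, Finset.mul_sum, Finset.mul_sum, ← Finset.sum_add_distrib, ← Finset.sum_add_distrib]
      refine Finset.sum_congr rfl fun k _ => ?_
      push_cast; ring
    rw [evalQR_cornerTerms, hsum, hα]
    push_cast; ring
  have hpp := hcorner 1 (by simp) 1 (by simp) v
  have hpm := hcorner 1 (by simp) (-1) (by simp) v
  have hmp := hcorner (-1) (by simp) 1 (by simp) v
  have hmm := hcorner (-1) (by simp) (-1) (by simp) v
  rw [hc] at hpp hpm hmp hmm
  push_cast at hpp hpm hmp hmm
  have haff := AffEncl.corners_nonneg (a₀ := (a₀ : ℝ)) (h₀ := (h₀ : ℝ)) (Δ := (Δ : ℝ)) (α := α) (β := β) (γ := γ)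
    (by linarith) (by linarith) (by linarith) (by linarith) ha hh
  -- combine
  have hlin : (∑ k, ((c₀ k : ℝ) + (c₁ k : ℝ) * (a - a₀) + (c₂ k : ℝ) * (h - h₀)) * evalQR (P k) v)
      = (∑ k, (c₀ k : ℝ) * evalQR (P k) v) + β * (a - a₀) + γ * (h - h₀) := by
    rw [hβ, hγ, Finset.sum_mul, Finset.sum_mul, ← Finset.sum_add_distrib, ← Finset.sum_add_distrib]
    refine Finset.sum_congr rfl fun k _ => ?_; ring
  rw [hlin] at h1
  rw [hα] at haff
  linarith [h1, h2, haff]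

end Summit.AtomisticToContinuum.Crystallization.Theorems.StrictSplittingRuleTorusLMI
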